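import Summits.AtomisticToContinuum.Crystallization.Theorems.FrustratedLawDichotomyDoublingGap

/-!
# FrustratedLawDichotomy · crux `AperiodicFrustratedLawGap` (stmt-AtomisticToContinuum-27623) — THE MASS-TRANSPORT (REDISTRIBUTION) LEMMA
# (decomp-a2c, prover hand 2, structural share, generation 3)

The law-level bridge between a LOCAL PRICE and the MEAN root energy.  A *covariant transport* is any jointly measurable
`F : Measure ℝ³ → ℝ³ → ℝ≥0∞`, read as "in the rooted configuration `μ` the root sends the mass `F μ y` to its atom `y`".  Its
out-flow at the root is `out_F μ = ∫⁻ y, F μ y ∂μ` and its in-flow is `in_F μ = ∫⁻ y, F (θ_y μ) (−y) ∂μ` (what the atom `y`, seen from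
its own rooted configuration `θ_y μ = μ.map (· − y)`, sends to the old root sitting at `−y`).  For a POINT-STATIONARY law the Mecke /
mass-transport identity (`IsPointStationaryLaw`, verbatim) says `E_P[out_F] = E_P[in_F]`; hence

* `integral_inflow_toReal_eq` — `∫ (in_F μ).toReal dP = ∫ (out_F μ).toReal dP` as soon as `E_P[out_F] < ∞` (hard-core laws, so that both
  flows are a.e.-measurable through the truncated identity kernel of the prelude);
* `lt_integral_rootEnergy_of_transport` — **if almost surely the REDISTRIBUTED root energy `rootEnergy μ + in_F μ − out_F μ` is `> c`,
  then `c < E_P[rootEnergy]`** (and `le_integral_rootEnergy_of_transport`, the non-strict form).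

This is the form in which every known crystallization proof is written (Heitmann–Radin, Theil: redistribute pair energies covariantly so
that EVERY atom's modified energy is at least the lattice value); for the crux it converts the law-level gap `e⋆ < E_P[rootEnergy]` into
the search for ONE covariant redistribution under which every atom of an admissible configuration is strictly above `e⋆` (doors in
`…TransportPriceDoor`).  All `[folklore]` (mass-transport principle, [AldousLyons2007 §2], [LastPenrose2017 Ch. 9]).
-/

noncomputable section

namespace Summit.AtomisticToContinuum.Crystallization.Theorems.FrustratedLawDichotomyTransportPrice

open MeasureTheory Metric Set Filter
open scoped ENNReal Topology BigOperators
open Literature.MathematicalPhysics.StatisticalMechanics Literature.Probability.Process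
open Summit.AtomisticToContinuum.Crystallization.Theorems.ChargedEnergyGapNegative (E3 eStar)
open Summit.AtomisticToContinuum.Crystallization.Theorems.FrustratedLawDichotomyFiniteClusterGap
  (aemeasurable_lintegral_of_ae_hardCore aemeasurable_lintegral_reroot_of_ae_hardCore integrable_rootEnergy_of_ae_hardCore)

variable {δ : ℝ} {P : Measure (Measure E3)} {F : Measure E3 → E3 → ℝ≥0∞}

/-- **Mass transport, Bochner form.**  For a point-stationary law almost surely carried by rooted `δ`-hard-core configurations and a jointly
measurable covariant transport `F` of finite mean out-flow, the in-flow `μ ↦ ∫⁻ y, F (θ_y μ) (−y) ∂μ` and the out-flow `μ ↦ ∫⁻ y, F μ y ∂μ` are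
almost surely finite, their real parts are integrable, and they have the same mean. [folklore] -/
theorem integral_inflow_toReal_eq (hδ : 0 < δ) (hcore : ∀ᵐ μ ∂P, IsRootedHardCore δ μ) (hstat : IsPointStationaryLaw P)
    (hF : Measurable (Function.uncurry F)) (hout : ∫⁻ μ, ∫⁻ y, F μ y ∂μ ∂P ≠ ∞) :
    (∀ᵐ μ ∂P, ∫⁻ y, F μ y ∂μ < ∞) ∧ (∀ᵐ μ ∂P, ∫⁻ y, F (μ.map fun z => z - y) (-y) ∂μ < ∞) ∧
      Integrable (fun μ => (∫⁻ y, F μ y ∂μ).toReal) P ∧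
      Integrable (fun μ => (∫⁻ y, F (μ.map fun z => z - y) (-y) ∂μ).toReal) P ∧
      ∫ μ, (∫⁻ y, F (μ.map fun z => z - y) (-y) ∂μ).toReal ∂P = ∫ μ, (∫⁻ y, F μ y ∂μ).toReal ∂P := by
  have hMTP : ∫⁻ μ, ∫⁻ y, F μ y ∂μ ∂P = ∫⁻ μ, ∫⁻ y, F (μ.map fun z => z - y) (-y) ∂μ ∂P := hstat F hF
  have hout_ae : AEMeasurable (fun μ => ∫⁻ y, F μ y ∂μ) P := aemeasurable_lintegral_of_ae_hardCore hδ hcore hF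
  have hin_ae : AEMeasurable (fun μ => ∫⁻ y, F (μ.map fun z => z - y) (-y) ∂μ) P :=
    aemeasurable_lintegral_reroot_of_ae_hardCore hδ hcore hF
  have hin : ∫⁻ μ, ∫⁻ y, F (μ.map fun z => z - y) (-y) ∂μ ∂P ≠ ∞ := hMTP ▸ hout
  have hout_lt : ∀ᵐ μ ∂P, ∫⁻ y, F μ y ∂μ < ∞ := ae_lt_top' hout_ae hout
  have hin_lt : ∀ᵐ μ ∂P, ∫⁻ y, F (μ.map fun z => z - y) (-y) ∂μ < ∞ := ae_lt_top' hin_ae hin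
  refine ⟨hout_lt, hin_lt, integrable_toReal_of_lintegral_ne_top hout_ae hout, integrable_toReal_of_lintegral_ne_top hin_ae hin, ?_⟩
  rw [integral_toReal hin_ae hin_lt, integral_toReal hout_ae hout_lt, hMTP]

/-- **Redistribution does not change the mean root energy.**  Under the hypotheses of `integral_inflow_toReal_eq`, the redistributed root
energy `rootEnergy V_LJ μ + in_F μ − out_F μ` is integrable and has mean `E_P[rootEnergy V_LJ]`. [folklore] -/
theorem integral_redistributed_eq (hδ : 0 < δ) [IsFiniteMeasure P] (hcore : ∀ᵐ μ ∂P, IsRootedHardCore δ μ) (hstat : IsPointStationaryLaw P)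
    (hF : Measurable (Function.uncurry F)) (hout : ∫⁻ μ, ∫⁻ y, F μ y ∂μ ∂P ≠ ∞) :
    Integrable (fun μ => rootEnergy lennardJones μ + (∫⁻ y, F (μ.map fun z => z - y) (-y) ∂μ).toReal - (∫⁻ y, F μ y ∂μ).toReal) P ∧
      ∫ μ, rootEnergy lennardJones μ + (∫⁻ y, F (μ.map fun z => z - y) (-y) ∂μ).toReal - (∫⁻ y, F μ y ∂μ).toReal ∂P =
        ∫ μ, rootEnergy lennardJones μ ∂P := by
  obtain ⟨-, -, hIout, hIin, heq⟩ := integral_inflow_toReal_eq hδ hcore hstat hF hout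
  have hIe : Integrable (fun μ => rootEnergy lennardJones μ) P := integrable_rootEnergy_of_ae_hardCore hδ hcore
  have hIs : Integrable (fun μ => rootEnergy lennardJones μ + (∫⁻ y, F (μ.map fun z => z - y) (-y) ∂μ).toReal) P := hIe.add hIin
  refine ⟨hIs.sub hIout, ?_⟩
  rw [integral_sub hIs hIout, integral_add hIe hIin, heq]
  ring

/-- **THE TRANSPORT LEMMA (strict form).**  Let `P` be a point-stationary probability law almost surely carried by rooted `δ`-hard-core
configurations and `F` a jointly measurable covariant transport of finite mean out-flow.  If almost surely the redistributed root energy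
`rootEnergy V_LJ μ + in_F μ − out_F μ` is STRICTLY above `c`, then `c < E_P[rootEnergy V_LJ]`. [folklore] -/
theorem lt_integral_rootEnergy_of_transport (hδ : 0 < δ) [IsProbabilityMeasure P] (hcore : ∀ᵐ μ ∂P, IsRootedHardCore δ μ)
    (hstat : IsPointStationaryLaw P) (hF : Measurable (Function.uncurry F)) (hout : ∫⁻ μ, ∫⁻ y, F μ y ∂μ ∂P ≠ ∞) {c : ℝ}
    (hprice : ∀ᵐ μ ∂P, c < rootEnergy lennardJones μ + (∫⁻ y, F (μ.map fun z => z - y) (-y) ∂μ).toReal - (∫⁻ y, F μ y ∂μ).toReal) :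
    c < ∫ μ, rootEnergy lennardJones μ ∂P := by
  obtain ⟨hI, heq⟩ := integral_redistributed_eq hδ hcore hstat hF hout
  rw [← heq]
  set g : Measure E3 → ℝ := fun μ =>
    rootEnergy lennardJones μ + (∫⁻ y, F (μ.map fun z => z - y) (-y) ∂μ).toReal - (∫⁻ y, F μ y ∂μ).toReal with hg
  have hIc : Integrable (fun μ => g μ - c) P := hI.sub (integrable_const c)
  have hnn : 0 ≤ᵐ[P] fun μ => g μ - c := by
    filter_upwards [hprice] with μ hμ
    exact sub_nonneg.mpr hμ.le
  by_contra hle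
  have hle' : ∫ μ, g μ ∂P ≤ c := not_lt.mp hle
  have hzero : ∫ μ, g μ - c ∂P = 0 := by
    refine le_antisymm ?_ (integral_nonneg_of_ae hnn)
    rw [integral_sub hI (integrable_const c), integral_const, smul_eq_mul, probReal_univ, one_mul]
    exact sub_nonpos.mpr hle'
  have hae : (fun μ => g μ - c) =ᵐ[P] 0 := (integral_eq_zero_iff_of_nonneg_ae hnn hIc).mp hzero
  have hfalse : ∀ᵐ μ ∂P, False := by
    filter_upwards [hprice, hae] with μ hμ h0
    have h0' : g μ - c = 0 := h0
    have hpos : 0 < g μ - c := sub_pos.mpr hμ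
    rw [h0'] at hpos
    exact lt_irrefl 0 hpos
  exact IsProbabilityMeasure.ne_zero P (ae_eq_bot.mp (Filter.eventually_false_iff_eq_bot.mp hfalse))

/-- **THE TRANSPORT LEMMA (non-strict form).**  Same hypotheses; if almost surely the redistributed root energy is `≥ c` then
`c ≤ E_P[rootEnergy V_LJ]`. [folklore] -/
theorem le_integral_rootEnergy_of_transport (hδ : 0 < δ) [IsProbabilityMeasure P] (hcore : ∀ᵐ μ ∂P, IsRootedHardCore δ μ)
    (hstat : IsPointStationaryLaw P) (hF : Measurable (Function.uncurry F)) (hout : ∫⁻ μ, ∫⁻ y, F μ y ∂μ ∂P ≠ ∞) {c : ℝ}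
    (hprice : ∀ᵐ μ ∂P, c ≤ rootEnergy lennardJones μ + (∫⁻ y, F (μ.map fun z => z - y) (-y) ∂μ).toReal - (∫⁻ y, F μ y ∂μ).toReal) :
    c ≤ ∫ μ, rootEnergy lennardJones μ ∂P := by
  obtain ⟨hI, heq⟩ := integral_redistributed_eq hδ hcore hstat hF hout
  rw [← heq]
  calc c = ∫ _μ, c ∂P := by rw [integral_const, smul_eq_mul, probReal_univ, one_mul]
    _ ≤ _ := integral_mono_ae (integrable_const c) hI hprice

/-- **Uniformly bounded out-flow is enough.**  If the out-flow is almost surely bounded by a constant `C`, its mean is finite (probability law).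
[folklore] -/
theorem lintegral_outflow_ne_top_of_bound [IsProbabilityMeasure P] {C : ℝ≥0∞} (hC : C ≠ ∞)
    (hbound : ∀ᵐ μ ∂P, ∫⁻ y, F μ y ∂μ ≤ C) : ∫⁻ μ, ∫⁻ y, F μ y ∂μ ∂P ≠ ∞ := by
  refine ne_top_of_le_ne_top hC ?_
  calc ∫⁻ μ, ∫⁻ y, F μ y ∂μ ∂P ≤ ∫⁻ _μ, C ∂P := lintegral_mono_ae hbound
    _ = C := by rw [lintegral_const, measure_univ, mul_one]

end Summit.AtomisticToContinuum.Crystallization.Theorems.FrustratedLawDichotomyTransportPrice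

end
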